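import Summits.KontsevichZagierPeriods.KontsevichZagierPeriods.Theorems.HurwitzMicroSectorsNormalFormPrincipleDilogBoxSubSimplex
import Summits.KontsevichZagierPeriods.KontsevichZagierPeriods.Theorems.HurwitzMicroSectorsNormalFormPrincipleDilogExistsSimplexPiecesOne
import Summits.KontsevichZagierPeriods.KontsevichZagierPeriods.Theorems.HurwitzMicroSectorsNormalFormPrincipleM3WdtBoxSubWedge
import Summits.KontsevichZagierPeriods.KontsevichZagierPeriods.Theorems.HurwitzMicroSectorsNormalFormPrincipleM3WdtWedgeSymmetrise
import Summits.KontsevichZagierPeriods.KontsevichZagierPeriods.Theorems.HurwitzMicroSectorsNormalFormPrincipleM3WdtWedgeSubTau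
import Summits.KontsevichZagierPeriods.KontsevichZagierPeriods.Theorems.HurwitzMicroSectorsNormalFormPrincipleM3WdtTauSubSimplex

/-!
# `NormalFormPrinciple` (stmt-KontsevichZagierPeriods-3869), line `SketchIdeator1` —
# leaf `stub_boxRigidity` in DIMENSION THREE: WeightDropTornheim `[(0,1)³, 1/((1−xy)(1−xz))] ∼ [(0,1)², 2/(1−xy)]`

Assembly file of the dimension-changing target of the crux idea `m3-equal-value-instances`
(strategist gen 2, `StrategistGen2.WeightDropTornheim`; lead seat c9, `--supports` the crux). The
box-rational representations `[(0,1)³, 1/((1−xy)(1−xz))]` and `[(0,1)², 2/(1−xy)]` have EQUAL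
values (`Σ_{m,n≥1} 1/(mn(m+n−1)) = ∫₀¹ log²(1−x)/x² dx = 2ζ(2)`), and no relation among
integrand identities / dilations / box symmetries / polynomial primitives explains it (N9). The
chain of moves (rules (1), (2), (3); no independence input):

1. the wedge chart `Ψ(x) = (x₀, x₀x₁, x₀x₂)` (rule 2, Jacobian `x₀²`) onto the wedge
   `V = {0 < t₁, t₂ < t₀ < 1}` with integrand `1/(t₀²(1−t₁)(1−t₂))` (`wdt_box_sub_wedge`);
2. symmetrisation across the null plane `t₁ = t₂` (rules 1a, 2): `[V] = 2·[V<]`,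
   `V< = {t₁ < t₂}` (`wdt_wedge_symmetrise`);
3. ONE Newton–Leibniz move along `t₀ ∈ [t₂, 1]` with the RATIONAL primitive
   `−1/(t₀(1−t₁)(1−t₂))` (rule 3 — the integration by parts `∫ log²(1−x) d((x−1)/x)` of the
   classical proof, done inside the calculus without a logarithm): the dimension drops and the
   base representation is `[{0 < y₀ < y₁ < 1}, 1/(y₁(1−y₀))]` (`wdt_wedge_sub_tau`);
4. which is the `ζ(2)`-simplex up to the coordinate swap (`wdt_tau_sub_simplex`), itself one
   merge–scale chart away from Beukers' box `[(0,1)², 1/(1−xy)]` (`Dilog.box_sub_simplex`), and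
   `[(0,1)², 2/(1−xy)] = 2·[(0,1)², 1/(1−xy)]` (rule 1b).

Sources: M. Kontsevich, D. Zagier, *Periods* (2001), §1.2; L. Tornheim, *Harmonic double series*,
Amer. J. Math. 72 (1950) (the value `Σ 1/(mn(m+n−1)) = 2ζ(2)`). No definitions are introduced.
-/

noncomputable section

open MeasureTheory Set
open Literature.NumberTheory.Transcendental Literature.NumberTheory.Transcendental.KZ
open Literature.ModelTheory.ExponentialFields (IsSemialgebraic)

namespace Summit.KontsevichZagierPeriods.HurwitzMicroSectors.NormalFormPrinciple.PiBox.M3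

/-- **WeightDropTornheim (`StrategistGen2.WeightDropTornheim`, crux idea
`m3-equal-value-instances`; registered sub-goal `weightDropTornheim` of
stmt-KontsevichZagierPeriods-3869, line `SketchIdeator1`).** Any representation of
`[(0,1)³, 1/((1−xy)(1−xz))]` is KZ-equivalent to any representation of `[(0,1)², 2/(1−xy)]`
(`Σ 1/(mn(m+n−1)) = 2ζ(2)`): a dimension-changing instance of the leaf `stub_boxRigidity`, both
sides box-rational, proved as a chain of moves — wedge chart, symmetrisation, ONE Newton–Leibniz
move with a rational primitive, swap, merge–scale chart, doubling.
[cite: KontsevichZagier2001, §1.2 rules (1)–(3)] -/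
theorem weightDropTornheim (r : IntegralRep 3) (r' : IntegralRep 2)
    (hrd : r.domain = {x | ∀ i, x i ∈ Set.Ioo (0:ℝ) 1})
    (hri : EqOn r.integrand (fun x => 1 / ((1 - x 0 * x 1) * (1 - x 0 * x 2)))
      {x | ∀ i, x i ∈ Set.Ioo (0:ℝ) 1})
    (hr'd : r'.domain = {x | ∀ i, x i ∈ Set.Ioo (0:ℝ) 1})
    (hr'i : EqOn r'.integrand (fun x => 2 / (1 - x 0 * x 1)) {x | ∀ i, x i ∈ Set.Ioo (0:ℝ) 1}) :
    Equivalent r r' := by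
  obtain ⟨hwedge, hexW⟩ := wdt_box_sub_wedge
  obtain ⟨W, hWd, hWi⟩ := hexW r hrd (hrd ▸ hri)
  obtain ⟨hsym, hexW'⟩ := wdt_wedge_symmetrise
  obtain ⟨W', hW'd, hW'i⟩ := hexW' W hWd (hWi ▸ fun _ _ => rfl)
  obtain ⟨S, hSd, hSi⟩ := Dilog.exists_simplexPieces_one.1 1 isAlgebraic_one one_pos le_rfl
  obtain ⟨htau, hexT⟩ := wdt_tau_sub_simplex
  obtain ⟨T, hTd, hTi⟩ := hexT S hSd (hSi ▸ fun _ _ => rfl)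
  obtain ⟨Z, hZd, hZi⟩ := Dilog.exists_dilogBox isAlgebraic_one (Or.inl le_rfl)
  have e1 : of r - of W ∈ relations := hwedge r W hrd (hrd ▸ hri) hWd (hWi ▸ fun _ _ => rfl)
  have e2 : of W - 2 • of W' ∈ relations :=
    hsym W W' hWd (hWi ▸ fun _ _ => rfl) hW'd (hW'i ▸ fun _ _ => rfl)
  have e3 : of W' - of T ∈ relations := wdt_wedge_sub_tau W' T hW'd (hW'i ▸ fun _ _ => rfl) hTd hTi
  have e4 : of T - of S ∈ relations := htau T S hTd hTi hSd (hSi ▸ fun _ _ => rfl)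
  have e5 : of Z - of S ∈ relations :=
    Dilog.box_sub_simplex.1 1 1 isAlgebraic_one le_rfl (by norm_num) Z S hZd (hZi ▸ fun _ _ => rfl)
      hSd (hSi ▸ fun _ _ => rfl)
  -- e6 : `[r'] − 2[Z]` (rule 1b on the box, carrier `Z + Z`)
  have e6 : of r' - 2 • of Z ∈ relations := by
    let ZZ : IntegralRep 2 :=
      ⟨Z.domain, fun x => Z.integrand x + Z.integrand x, Z.isSemialgebraic_domain,
        (IsSemialgebraicFunOn.add_holds Z.isSemialgebraicFunOn_integrand
          Z.isSemialgebraicFunOn_integrand).congr fun _ _ => rfl,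
        Z.integrableOn.add Z.integrableOn⟩
    have h1 : of ZZ - of Z - of Z ∈ relations :=
      integrandAddRel_subset_relations ⟨2, ZZ, Z, Z, rfl, rfl, fun _ _ => rfl, rfl⟩
    have h2 : of r' - of ZZ ∈ relations := by
      refine of_sub_of_mem_relations_of_eqOn (hZd.trans hr'd.symm) fun x hx => ?_
      have hx' : ∀ i, x i ∈ Set.Ioo (0:ℝ) 1 := by rw [hr'd] at hx; exact hx
      show r'.integrand x = Z.integrand x + Z.integrand x
      rw [hr'i hx', hZi]
      ring
    have e : of r' - 2 • of Z = (of r' - of ZZ) + (of ZZ - of Z - of Z) := by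
      simp only [two_smul]; abel
    rw [e]
    exact relations.add_mem h2 h1
  have e : of r - of r' = (of r - of W) + (of W - 2 • of W') + 2 • (of W' - of T) + 2 • (of T - of S)
      - 2 • (of Z - of S) - (of r' - 2 • of Z) := by
    simp only [smul_sub]; abel
  show of r - of r' ∈ relations
  rw [e]
  exact relations.sub_mem (relations.sub_mem (relations.add_mem (relations.add_mem
    (relations.add_mem e1 e2) (relations.nsmul_mem e3 2)) (relations.nsmul_mem e4 2))
    (relations.nsmul_mem e5 2)) e6

end Summit.KontsevichZagierPeriods.HurwitzMicroSectors.NormalFormPrinciple.PiBox.M3
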